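import Literature.Topology.FourManifolds.FishtailEndInj
import Literature.Topology.FourManifolds.FishtailTubeTN
import Literature.Topology.FourManifolds.FishtailEmbedding
import Literature.Topology.FourManifolds.GompfTwistNbhdFatSlab
import HarnessLib

/-!
# The geometric hypotheses of the fishtail end map hold for the concrete data

Infrastructure for the explicit fishtail neighbourhood (R. Gompf, *More Cappell–Shaneson spheres
are standard*, Algebr. Geom. Topol. 10 (2010), proof of Thm 2.1 and Lemma 2.2; the named fact
`Literature.Topology.FourManifolds.gompf2010_framedTwist`). For the concrete data `fishJ` with
turn depths `e_a = E₁/4 < e_b = E₁/2` and band width `η' = h E₁/4` we verify the fields of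
`IotaData.EndHyp`:

* `memY` — the image of the model end misses the far sliver `Σ`;
* `turn` — on the band neighbourhood of `Σ` only shallow box points of the flat top sector occur,
  and there the base turn (a full turn, `u = 2π`, acting on the fibre by `e^{2πi κ₀}`) is carried to
  the sliver twist of Gompf's far Dehn twist (`circleExp_two_pi_mul_kap0`);
* `fix` — every point of the band neighbourhood moved by the sliver twist is the image of a
  shallow box point;
* `hK`, `hKT` — the closure of the image of the moved set lies in the band set over the far
  support together with the image of the compact deep set, hence in the image of the end away from
  `Σ` and in the twisted cylinder neighbourhood `twistNbhd ψ 1 (axisTube r)` (`2ε ≤ r`).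

Everything is proved; no named facts.

## References

* R. E. Gompf, *More Cappell–Shaneson spheres are standard*, Algebr. Geom. Topol. 10 (2010)
  1665–1681, proof of Thm 2.1 (last paragraph) and Lemma 2.2 (proof). [GompfAGT2010]
-/

noncomputable section

open scoped Real Topology ContDiff Manifold
open Set Filter Complex Metric

namespace Literature.Topology.FourManifolds

local notation "𝔼 " n:arg => EuclideanSpace ℝ (Fin n)
local notation "𝓣" =>
  (ModelWithCorners.prod (𝓡 1) (ModelWithCorners.prod (𝓡 1) (𝓡 1)))

namespace FP

variable {ε : ℝ} (hε : 0 < ε) (hε2 : ε ≤ 1 / 2)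

/-! ### Parameters -/

/-- The band width `η' = h E₁ / 4`. [folklore] -/
def etaP : ℝ := bxH * E1 / 4
/-- The full-turn depth `e_a = E₁ / 4`. [folklore] -/
def eaP : ℝ := E1 / 4
/-- The no-turn depth `e_b = E₁ / 2`. [folklore] -/
def ebP : ℝ := E1 / 2

/-- `0 < etaP`. [folklore] -/
theorem etaP_pos : 0 < etaP := by unfold etaP bxH; linarith [E1_pos]
/-- `etaP ≤ 1 / 2000`. [folklore] -/
theorem etaP_le : etaP ≤ 1 / 2000 := by unfold etaP bxH; linarith [E1_le]
/-- `eaP < ebP`. [folklore] -/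
theorem eaP_lt_ebP : eaP < ebP := by unfold eaP ebP; linarith [E1_pos]
/-- `E1 ≤ 1 / 2`. [folklore] -/
theorem E1_le_half : E1 ≤ 1 / 2 := by linarith [E1_le]

/-! ### Old points of the second cylinder -/

/-- `[x, t] = inr b` for `t ∈ (1/2, 3/2)` pins `b` down. [folklore] -/
theorem eq_of_mtPt_eq_inr {x : ThreeTorus} {t : ℝ} (ht : 1 / 2 < t ∧ t < 3 / 2) {b : ThreeTorus × ↥mappingTorusPieceTwo}
    (h : mtPt tubeShearDiffeo x t = (mtGlueData tubeShearDiffeo).inr b) : b.1 = x ∧ (b.2 : ℝ) = t := by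
  rw [mtPt_of_mem_two x ht] at h
  have := (mtGlueData tubeShearDiffeo).inr_injective h
  rw [← this]; exact ⟨rfl, rfl⟩

/-- A second-cylinder point with `re z₂ < 0` is far. [folklore] -/
theorem far_inr_of_re_neg {b : ThreeTorus × ↥mappingTorusPieceTwo} (hb : ((b.1.2.1 : Circle) : ℂ).re < 0) :
    Far ((mtGlueData tubeShearDiffeo).inr b) := by
  have hπ := Real.pi_gt_three; have hπ4 := Real.pi_lt_d2
  set z : ℂ := ((b.1.2.1 : Circle) : ℂ) with hz
  have harg : π / 2 < |arg z| := by
    by_contra hcon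
    have := Complex.abs_arg_le_pi_div_two_iff.1 (not_lt.1 hcon)
    linarith
  have hle := Complex.arg_le_pi z; have hgt := Complex.neg_pi_lt_arg z
  rcases le_or_gt 0 (arg z) with h0 | h0
  · refine ⟨arg z, ?_, by rw [abs_of_nonneg h0] at harg; linarith, by linarith⟩
    rw [yC_inr]; exact (Circle.exp_arg b.1.2.1).symm
  · refine ⟨arg z + 2 * π, ?_, by rw [abs_of_neg h0] at harg; linarith, by rw [abs_of_neg h0] at harg; linarith⟩
    rw [yC_inr, Circle.exp_add, Circle.exp_two_pi, mul_one]; exact (Circle.exp_arg b.1.2.1).symm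

/-- A band-neighbourhood point is far and has base in `(1 - η', 1 + η')`. [folklore] -/
theorem far_of_mem_bandNbhd {η' : ℝ} {b : ThreeTorus × ↥mappingTorusPieceTwo} (hb : b ∈ bandNbhd η') :
    Far ((mtGlueData tubeShearDiffeo).inr b) ∧ ((b.1.2.1 : Circle) : ℂ).re < -Real.cos (1 / 8) ∧
      1 - η' < (b.2 : ℝ) ∧ (b.2 : ℝ) < 1 + η' := by
  have hcos : 0 < Real.cos (1 / 8) := Real.cos_pos_of_mem_Ioo ⟨by linarith [Real.pi_gt_three], by linarith [Real.pi_gt_three]⟩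
  exact ⟨far_inr_of_re_neg (by linarith [hb.1]), hb.1, ((mem_bicollarPiece η').1 hb.2).1, ((mem_bicollarPiece η').1 hb.2).2⟩

/-- `cos (3/20) < cos (1/8) < cos (1/10)`: the corner is off the band, the sliver is in it. [folklore] -/
theorem cos_band : Real.cos (3 / 20) < Real.cos (1 / 8) ∧ Real.cos (1 / 8) < Real.cos (1 / 10) ∧ 99 / 100 < Real.cos (1 / 8) := by
  have hπ := Real.pi_gt_three
  refine ⟨Real.cos_lt_cos_of_nonneg_of_le_pi_div_two (by norm_num) (by linarith) (by norm_num),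
    Real.cos_lt_cos_of_nonneg_of_le_pi_div_two (by norm_num) (by linarith) (by norm_num), ?_⟩
  have := Real.one_sub_sq_div_two_le_cos (x := 1 / 8)
  linarith

/-- **Fibre angles read on the band**: `cos y < -cos (1/8)` with `y ∈ (1, 5)` gives `|y - π| < 1/8`. [folklore] -/
theorem abs_sub_pi_lt_of_cos_lt {y : ℝ} (hy1 : 1 < y) (hy5 : y < 5) (h : Real.cos y < -Real.cos (1 / 8)) : |y - π| < 1 / 8 := by
  have hπ := Real.pi_gt_three; have hπ' := Real.pi_lt_d2
  by_contra hcon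
  rw [not_lt] at hcon
  have hyπ : |y - π| ≤ π := by rw [abs_le]; constructor <;> linarith
  have := Real.cos_le_cos_of_nonneg_of_le_pi (by norm_num) hyπ hcon
  rw [Real.cos_abs, Real.cos_sub_pi] at this
  linarith

/-! ### The image misses the far sliver -/

section MemY

/-- **Old points off the far sliver lie in `Y`.** [folklore] -/
theorem toSurg_mem_Yop {m : MTorus tubeShearDiffeo} (hm : ∀ b ∈ fibreSliver (farSupport tauFar), (mtGlueData tubeShearDiffeo).inr b ≠ m) :
    toSurg (fishNu hε hε2) m ∈ (fishJ ε hε hε2).Yop := by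
  rw [toSurg]
  split_ifs with h
  · exact CircleNbhd.inl_mem_localOpens _ ((mem_prodSliverCompl_iff _ _ _).2 hm)
  · refine CircleNbhd.inl_mem_localOpens _ ((mem_prodSliverCompl_iff _ _ _).2 fun b hb hbm ↦ ?_)
    -- the base point is a tube point: its fibre angle is small
    obtain ⟨v, hv, hyv⟩ := yC_of_mem_range hε hε2 (p := ((fishNu hε hε2).basePtA : MTorus tubeShearDiffeo)) ⟨_, rfl⟩
    rw [← hbm, yC_inr] at hyv
    have hre : ((b.1.2.1 : Circle) : ℂ).re ≤ Real.cos (π - tauFar) := hb.1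
    rw [hyv, Circle.coe_exp, Complex.exp_ofReal_mul_I_re, Real.cos_pi_sub] at hre
    have hv1 : |v 1| < ε := lt_of_le_of_lt (by rw [← Real.norm_eq_abs]; exact PiLp.norm_apply_le v 1) hv
    have hcos : 0 < Real.cos (v 1) := Real.cos_pos_of_mem_Ioo ⟨by linarith [(abs_lt.1 hv1).1, Real.pi_gt_three],
      by linarith [(abs_lt.1 hv1).2, Real.pi_gt_three]⟩
    have hτ : 0 < Real.cos tauFar := Real.cos_pos_of_mem_Ioo ⟨by rw [tauFar]; linarith [Real.pi_gt_three], by rw [tauFar]; linarith [Real.pi_gt_three]⟩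
    linarith

/-- An old point with small fibre angle lies in `Y`. [folklore] -/
theorem toSurg_mem_Yop_of_yC {m : MTorus tubeShearDiffeo} {y : ℝ} (hy : yC m = Circle.exp y) (hy' : |y| ≤ 1 / 2) :
    toSurg (fishNu hε hε2) m ∈ (fishJ ε hε hε2).Yop := by
  refine toSurg_mem_Yop hε hε2 fun b hb hbm ↦ ?_
  have hre : ((b.1.2.1 : Circle) : ℂ).re ≤ Real.cos (π - tauFar) := hb.1
  rw [← hbm, yC_inr] at hy
  rw [hy, Circle.coe_exp, Complex.exp_ofReal_mul_I_re, Real.cos_pi_sub] at hre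
  have hcos : 0 < Real.cos y := Real.cos_pos_of_mem_Ioo ⟨by linarith [(abs_le.1 hy').1, Real.pi_gt_three],
    by linarith [(abs_le.1 hy').2, Real.pi_gt_three]⟩
  have hτ : 0 < Real.cos tauFar := Real.cos_pos_of_mem_Ioo ⟨by rw [tauFar]; linarith [Real.pi_gt_three], by rw [tauFar]; linarith [Real.pi_gt_three]⟩
  linarith

/-- An old point `[x, t]`, `1/2 < t < 3/2`, `t ≠ 1`, lies in `Y`. [folklore] -/
theorem toSurg_mtPt_mem_Yop_of_ne {x : ThreeTorus} {t : ℝ} (ht : 1 / 2 < t ∧ t < 3 / 2) (ht1 : t ≠ 1) :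
    toSurg (fishNu hε hε2) (mtPt tubeShearDiffeo x t) ∈ (fishJ ε hε hε2).Yop := by
  refine toSurg_mem_Yop hε hε2 fun b hb hbm ↦ ht1 ?_
  rw [← (eq_of_mtPt_eq_inr ht hbm.symm).2]; exact hb.2

/-- An old point `[x, t]`, `1/2 < t < 3/2`, with `re z₂ > -cos τ` lies in `Y`. [folklore] -/
theorem toSurg_mtPt_mem_Yop_of_re {x : ThreeTorus} {t : ℝ} (ht : 1 / 2 < t ∧ t < 3 / 2)
    (hre : -Real.cos tauFar < ((x.2.1 : Circle) : ℂ).re) :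
    toSurg (fishNu hε hε2) (mtPt tubeShearDiffeo x t) ∈ (fishJ ε hε hε2).Yop := by
  refine toSurg_mem_Yop hε hε2 fun b hb hbm ↦ ?_
  have h1 := (eq_of_mtPt_eq_inr ht hbm.symm).1
  have : ((b.1.2.1 : Circle) : ℂ).re ≤ Real.cos (π - tauFar) := hb.1
  rw [h1, Real.cos_pi_sub] at this; linarith

include hε2 in
/-- **The hole piece lands in `Y`.** [folklore] -/
theorem hole_mem_Yop {x : ThreeTorus} (hx : 0 < (x.1 : ℂ).im) {s : ℝ} (h1 : ‖(fishJ ε hε hε2).holeP0 x s‖ < (fishJ ε hε hε2).rh) :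
    (fishJ ε hε hε2).holeP x s ∈ (fishJ ε hε hε2).Yop := by
  obtain ⟨ht, hζ, hw, -⟩ := hole_tube hε hε2 hx h1
  rw [ht]
  rcases hole_taxonomy hε hε2 (q := ((fishJ ε hε hε2).holeZeta x s, ((fishJ ε hε hε2).holeW x s).re, ((fishJ ε hε hε2).holeW x s).im)) hw hζ with
    ⟨d, hd⟩ | ⟨m, y, hm, hyC, hy⟩ | ⟨X, t, y, hm, ht0, ht1, -⟩ | ⟨X, t, hm, ht0, ht1⟩
  · rw [hd]; exact CircleNbhd.inr_mem_localOpens _ d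
  · rw [hm]; exact toSurg_mem_Yop_of_yC hε hε2 hyC hy
  · rw [hm]; exact toSurg_mtPt_mem_Yop_of_ne hε hε2 ⟨ht0, by linarith⟩ (by linarith)
  · rw [hm]; rw [tH_eq] at ht1; exact toSurg_mtPt_mem_Yop_of_ne hε hε2 ⟨ht0, by linarith⟩ (by linarith)

include hε2 in
/-- **`memY`: the end map lands in `Y = X^σ ∖ Σ`.** [cite: GompfAGT2010, Lemma 2.2 (proof: the end of Φ off the cut)] -/
theorem memY (H : (fishJ ε hε hε2).ModelHyp) : ∀ p ∈ (fishJ ε hε hε2).endO H, (fishJ ε hε hε2).iota H p ∈ (fishJ ε hε hε2).Yop := by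
  intro p hp
  obtain ⟨x, s, hs0, hs1, rfl⟩ := exists_mtPt_rep p
  rw [IotaData.mem_endO, z1Of_mtPt hε hε2 H x (by linarith) hs1] at hp
  rw [iota_mtPt hε hε2 H x hs0 hs1]
  obtain ⟨hcos1, hcos2, -⟩ := cos_band
  rcases iotaTwo_modes hε hε2 x s with ⟨-, hp1, hv⟩ | ⟨-, hp1, hp2, hv⟩ | ⟨-, hv⟩ <;> rw [hv]
  · exact hole_mem_Yop hε hε2 hp hp1
  · rw [cornerP_eq]
    obtain ⟨-, hS1, hS2, hWi, -⟩ := far_corner hε hε2 hp hp1 hp2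
    refine toSurg_mtPt_mem_Yop_of_re hε hε2 ⟨by linarith, hS2⟩ ?_
    show -Real.cos tauFar < ((Circle.exp (cY + cW hε hε2 x s * (cU hε hε2 x s).im) : Circle) : ℂ).re
    rw [Circle.coe_exp, Complex.exp_ofReal_mul_I_re, tauFar]
    have hcY : cY = π - 1 / 4 := rfl
    obtain ⟨a1, a2⟩ := abs_le.1 hWi
    -- `cos (c_Y + W im u) ≥ cos (π - 3/20) = -cos (3/20) > -cos (1/10)`
    have hle : Real.cos (π - 3 / 20) ≤ Real.cos (cY + cW hε hε2 x s * (cU hε hε2 x s).im) :=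
      Real.cos_le_cos_of_nonneg_of_le_pi (by linarith [Real.pi_gt_three]) (by linarith [Real.pi_gt_three]) (by linarith)
    rw [Real.cos_pi_sub] at hle
    linarith
  · rw [boxP_eq]
    obtain ⟨ht1, ht2, -⟩ := box_mem hε hε2 hp s
    obtain ⟨he0, -⟩ := depth_mem' hε hε2 hp
    have htb : 1 < faceT (thetaV s) ((fishJ ε hε hε2).depth x.1) := by rw [bxH] at ht1; linarith
    exact toSurg_mtPt_mem_Yop_of_ne hε hε2 ⟨by linarith, by linarith⟩ htb.ne'

end MemY

/-! ### The base turn is carried to the sliver twist on the band neighbourhood -/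

section Turn

/-- **On the band neighbourhood only box points occur.** [folklore] -/
theorem box_of_eq_inr {x : ThreeTorus} (hx : 0 < (x.1 : ℂ).im) {s : ℝ}
    {b : ThreeTorus × ↥mappingTorusPieceTwo} (hb : b ∈ bandNbhd etaP)
    (h : (fishJ ε hε hε2).iotaTwo (x, s) = toSurg (fishNu hε hε2) ((mtGlueData tubeShearDiffeo).inr b)) :
    (fishJ ε hε hε2).rc ≤ (fishJ ε hε hε2).holeDist x s ∧ (fishJ ε hε hε2).iotaTwo (x, s) = (fishJ ε hε hε2).boxP x s ∧
      b.1 = (Circle.exp ((fishJ ε hε hε2).lat x.2.1) * (x.2.2 * (fishJ ε hε hε2).twistC ((fishJ ε hε hε2).lat x.2.1) s)⁻¹,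
        Circle.exp (faceY (thetaV s) ((fishJ ε hε hε2).depth x.1)), x.2.2 * (fishJ ε hε hε2).twistC ((fishJ ε hε hε2).lat x.2.1) s) ∧
      (b.2 : ℝ) = faceT (thetaV s) ((fishJ ε hε hε2).depth x.1) := by
  obtain ⟨hfar, hre, ht1, ht2⟩ := far_of_mem_bandNbhd hb
  obtain ⟨hcos1, hcos2, hcos3⟩ := cos_band
  have hη := etaP_le
  rcases iotaTwo_modes hε hε2 x s with ⟨-, hp1, hv⟩ | ⟨-, hp1, hp2, hv⟩ | ⟨hbox, hv⟩
  · exfalso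
    rw [hv] at h
    obtain ⟨ht, hζ, hw, -⟩ := hole_tube hε hε2 hx hp1
    rw [ht] at h
    rcases hole_taxonomy hε hε2 (q := ((fishJ ε hε hε2).holeZeta x s, ((fishJ ε hε hε2).holeW x s).re, ((fishJ ε hε hε2).holeW x s).im)) hw hζ with
      ⟨d, hd⟩ | ⟨m, y, hm, hyC, hy⟩ | ⟨X, t, y, hm, ht0, ht1', -⟩ | ⟨X, t, hm, ht0, ht1'⟩
    · rw [hd] at h; exact hfar.toSurg_ne_inr hε hε2 d h.symm
    · rw [hm] at h
      have hmm := hfar.eq_of_toSurg_eq hε hε2 h.symm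
      rw [← hmm, yC_inr] at hyC
      rw [hyC, Circle.coe_exp, Complex.exp_ofReal_mul_I_re] at hre
      have hcos : 0 < Real.cos y := Real.cos_pos_of_mem_Ioo ⟨by linarith [(abs_le.1 hy).1, Real.pi_gt_three],
        by linarith [(abs_le.1 hy).2, Real.pi_gt_three]⟩
      linarith
    · rw [hm] at h
      have hmm := hfar.eq_of_toSurg_eq hε hε2 h.symm
      have := (eq_of_mtPt_eq_inr ⟨ht0, by linarith⟩ hmm.symm).2
      linarith
    · rw [hm] at h
      have hmm := hfar.eq_of_toSurg_eq hε hε2 h.symm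
      have := (eq_of_mtPt_eq_inr ⟨ht0, by rw [tH_eq] at ht1'; linarith⟩ hmm.symm).2
      rw [tH_eq] at ht1'; linarith
  · exfalso
    rw [hv, cornerP_eq] at h
    obtain ⟨hfc, hS1, hS2, hWi, -⟩ := far_corner hε hε2 hx hp1 hp2
    have hmm := hfc.eq_of_toSurg_eq hε hε2 h
    have h1 := (eq_of_mtPt_eq_inr ⟨by linarith, hS2⟩ hmm).1
    rw [h1] at hre
    simp only [Circle.coe_exp, Complex.exp_ofReal_mul_I_re] at hre
    have hcY : cY = π - 1 / 4 := rfl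
    obtain ⟨a1, a2⟩ := abs_le.1 hWi
    have hle : Real.cos (π - 3 / 20) ≤ Real.cos (cY + cW hε hε2 x s * (cU hε hε2 x s).im) :=
      Real.cos_le_cos_of_nonneg_of_le_pi (by linarith [Real.pi_gt_three]) (by linarith [Real.pi_gt_three]) (by linarith)
    rw [Real.cos_pi_sub] at hle
    linarith
  · rw [hv, boxP_eq] at h
    obtain ⟨hT1, hT2, -⟩ := box_mem hε hε2 hx s
    obtain ⟨he0, -⟩ := depth_mem' hε hε2 hx
    have htb : 1 < faceT (thetaV s) ((fishJ ε hε hε2).depth x.1) := by rw [bxH] at hT1; linarith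
    have hmm := (far_box hε hε2 hx s).eq_of_toSurg_eq hε hε2 h
    obtain ⟨hb1, hb2⟩ := eq_of_mtPt_eq_inr ⟨by linarith, by linarith⟩ hmm
    exact ⟨hbox, hv, hb1, hb2⟩

/-- **Box points of the band neighbourhood are shallow points of the flat top sector.** [folklore] -/
theorem top_of_band {x : ThreeTorus} (hx : 0 < (x.1 : ℂ).im) {s : ℝ} (hs : 1 / 2 ≤ s ∧ s < 3 / 2)
    (hT : faceT (thetaV s) ((fishJ ε hε hε2).depth x.1) < 1 + etaP)
    (hY : Real.cos (faceY (thetaV s) ((fishJ ε hε hε2).depth x.1)) < -Real.cos (1 / 8)) :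
    |thetaV s - π / 2| ≤ bxPhi1 ∧ 0 < s - 1 ∧ s - 1 < 1 / 4 ∧ (fishJ ε hε hε2).depth x.1 < eaP ∧
      faceT (thetaV s) ((fishJ ε hε hε2).depth x.1) = 1 + (fishJ ε hε hε2).depth x.1 * bxH ∧
      faceY (thetaV s) ((fishJ ε hε hε2).depth x.1) = faceYs ((fishJ ε hε hε2).depth x.1) (s - 1) ∧
      |faceY (thetaV s) ((fishJ ε hε hε2).depth x.1) - π| < 1 / 8 := by
  have hπ := Real.pi_gt_three; have hπ4 := Real.pi_lt_d2
  obtain ⟨he0, he1⟩ := depth_mem' hε hε2 hx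
  set e := (fishJ ε hε hε2).depth x.1 with he
  have hE := E1_le
  have hη : etaP = bxH * E1 / 4 := rfl
  obtain ⟨-, -, hy⟩ := box_mem hε hε2 hx s
  obtain ⟨hc1, hc2⟩ := cos_bxPhi
  have h10 : 0 < Real.sqrt 10 := Real.sqrt_pos.2 (by norm_num)
  have hcY : cY = π - 1 / 4 := rfl
  -- the fibre angle is in the band
  have hband : |faceY (thetaV s) e - π| < 1 / 8 := by
    obtain ⟨a1, a2⟩ := abs_le.1 hy
    exact abs_sub_pi_lt_of_cos_lt (by linarith) (by linarith) hY
  -- top sector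
  have htop : Real.cos bxPhi1 ≤ Real.sin (thetaV s) := by
    by_contra hcon
    rw [not_le] at hcon
    rcases le_or_gt (Real.sin (thetaV s)) (Real.cos bxPhi2) with hbot | hblend
    · have := faceT_bottom_gt hbot he0 he1
      rw [hη, bxH] at hT; rw [bxH] at this; linarith
    · -- blend: `(1 - e) R sin θ > h - η'` and `|cos θ| > 3 sin θ`
      have hsinpos : 0 < Real.sin (thetaV s) := lt_trans (by rw [hc2]; positivity) hblend
      have hR0 := bxR_pos (thetaV s)
      have h1 : bxH - etaP < (1 - e) * bxR (thetaV s) * Real.sin (thetaV s) := by rw [faceT] at hT; linarith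
      have hcos3 : 3 * Real.sin (thetaV s) < |Real.cos (thetaV s)| := by
        have hsq := Real.sin_sq_add_cos_sq (thetaV s)
        have hs2 : Real.sin (thetaV s) ^ 2 < 1 / 10 := by
          rw [hc1] at hcon
          have : Real.sin (thetaV s) ^ 2 < (1 / Real.sqrt 10) ^ 2 := pow_lt_pow_left₀ hcon hsinpos.le two_ne_zero
          rw [div_pow, one_pow, Real.sq_sqrt (by norm_num)] at this; exact this
        have hc9 : (3 * Real.sin (thetaV s)) ^ 2 < |Real.cos (thetaV s)| ^ 2 := by
          rw [sq_abs, mul_pow]; norm_num; linarith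
        exact lt_of_pow_lt_pow_left₀ 2 (abs_nonneg _) hc9
      have hpos : 0 < (1 - e) * bxR (thetaV s) := mul_pos (by linarith) hR0
      have hdev : 3 * (bxH - etaP) < |faceY (thetaV s) e - cY| := by
        rw [faceY, add_sub_cancel_left, abs_mul, abs_of_pos hpos]
        have h4 := mul_lt_mul_of_pos_left hcos3 hpos
        have h5 : (1 - e) * bxR (thetaV s) * (3 * Real.sin (thetaV s)) = 3 * ((1 - e) * bxR (thetaV s) * Real.sin (thetaV s)) := by ring
        linarith
      have := etaP_le
      rw [bxH] at hdev
      obtain ⟨b1, b2⟩ := abs_lt.1 hband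
      have h38 : |faceY (thetaV s) e - cY| < 3 / 8 := by rw [abs_lt]; constructor <;> linarith
      linarith
  have hφπ : |2 * π * (s - 1)| ≤ π := by
    rw [abs_mul, abs_of_pos (by positivity : (0:ℝ) < 2 * π)]
    have : |s - 1| ≤ 1 / 2 := abs_le.2 ⟨by linarith [hs.1], by linarith [hs.2]⟩
    nlinarith
  rw [sin_thetaV] at htop
  obtain ⟨hφabs, h25⟩ := abs_le_bxPhi1_of_cos_le htop hφπ
  have hθ : |thetaV s - π / 2| ≤ bxPhi1 := by
    rw [abs_thetaV_sub, ← abs_of_pos (by positivity : (0:ℝ) < 2 * π), ← abs_mul]; exact hφabs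
  have hflatT := faceT_flat hθ e
  have hflatY := faceY_flat_thetaV hθ e
  -- depth
  have hea : e < eaP := by rw [hflatT, hη] at hT; rw [eaP]; rw [bxH] at hT; linarith
  -- `σ ∈ (0, 1/4)`
  have hφ1 : |2 * π * (s - 1)| < π / 2 := lt_of_le_of_lt hφabs bxPhi1_lt_bxPhi2 |>.trans bxPhi2_lt
  obtain ⟨hφl, hφr⟩ := abs_lt.1 hφ1
  have h2π : (0:ℝ) < 2 * π := by positivity
  have hσ4 : s - 1 < 1 / 4 := lt_of_mul_lt_mul_left (by linarith : 2 * π * (s - 1) < 2 * π * (1 / 4)) h2π.le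
  have hσ0 : 0 < s - 1 := by
    -- `y = c_Y + (1 - e) h tan (2πσ) > π - 1/8 > c_Y` forces `tan > 0`
    have hygt : cY < faceY (thetaV s) e := by obtain ⟨b1, -⟩ := abs_lt.1 hband; linarith
    rw [hflatY] at hygt
    have h1e : 0 < (1 - e) * bxH := mul_pos (by linarith) (by rw [bxH]; norm_num)
    have h3 : 0 < (1 - e) * bxH * Real.tan (2 * π * (s - 1)) := by linarith
    have htan : 0 < Real.tan (2 * π * (s - 1)) := pos_of_mul_pos_right h3 h1e.le
    by_contra hcon
    rw [not_lt] at hcon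
    have : Real.tan (2 * π * (s - 1)) ≤ 0 := by
      rcases hcon.lt_or_eq with hlt | heq
      · exact (Real.tan_neg_of_neg_of_pi_div_two_lt (mul_neg_of_pos_of_neg h2π hlt) hφl).le
      · rw [heq, mul_zero, Real.tan_zero]
    linarith
  exact ⟨hθ, hσ0, hσ4, hea, hflatT, hflatY, hband⟩

/-- The hole distance does not see the fibre coordinate `z₃`. [folklore] -/
theorem holeDist_congr (x : ThreeTorus) (z : Circle) (s : ℝ) :
    (fishJ ε hε hε2).holeDist (x.1, x.2.1, z) s = (fishJ ε hε hε2).holeDist x s := rfl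

/-- The box shell after rotating the fibre coordinate. [folklore] -/
theorem boxP_rotate (x : ThreeTorus) (w : Circle) (s : ℝ) : (fishJ ε hε hε2).boxP (x.1, x.2.1, x.2.2 * w) s =
    toSurg (fishNu hε hε2) (mtPt tubeShearDiffeo
      (Circle.exp ((fishJ ε hε hε2).lat x.2.1) * (x.2.2 * (fishJ ε hε hε2).twistC ((fishJ ε hε hε2).lat x.2.1) s)⁻¹ * w⁻¹,
        Circle.exp (faceY (thetaV s) ((fishJ ε hε hε2).depth x.1)), x.2.2 * (fishJ ε hε hε2).twistC ((fishJ ε hε hε2).lat x.2.1) s * w)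
      (faceT (thetaV s) ((fishJ ε hε hε2).depth x.1))) := by
  rw [boxP_eq]
  congr 2
  refine Prod.ext ?_ (Prod.ext rfl (mul_right_comm _ _ _))
  apply Subtype.ext
  simp only [Circle.coe_mul, Circle.coe_inv]
  field_simp

/-- The box mode is stable under rotating the fibre coordinate. [folklore] -/
theorem iotaTwo_rotate_of_box {x : ThreeTorus} {s : ℝ} (hbox : (fishJ ε hε hε2).rc ≤ (fishJ ε hε hε2).holeDist x s) (w : Circle) :
    (fishJ ε hε hε2).iotaTwo ((x.1, x.2.1, x.2.2 * w), s) = (fishJ ε hε hε2).boxP (x.1, x.2.1, x.2.2 * w) s := by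
  rcases iotaTwo_modes hε hε2 (x.1, x.2.1, x.2.2 * w) s with ⟨hs, hp, -⟩ | ⟨hs, -, hp, -⟩ | ⟨-, hv⟩
  · exfalso
    have hd : (fishJ ε hε hε2).holeDist x s = ‖(fishJ ε hε hε2).holeP0 x s‖ := by rw [IotaData.holeDist, if_pos hs]
    obtain ⟨-, -, -, hrhρ, hρrc, -⟩ := radii hε hε2
    have : ‖(fishJ ε hε hε2).holeP0 (x.1, x.2.1, x.2.2 * w) s‖ = ‖(fishJ ε hε hε2).holeP0 x s‖ := rfl
    linarith
  · exfalso
    have hd : (fishJ ε hε hε2).holeDist x s = ‖(fishJ ε hε hε2).holeP0 x s‖ := by rw [IotaData.holeDist, if_pos hs]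
    have : ‖(fishJ ε hε hε2).holeP0 (x.1, x.2.1, x.2.2 * w) s‖ = ‖(fishJ ε hε hε2).holeP0 x s‖ := rfl
    linarith
  · exact hv

include hε2 in
/-- **`turn`: on the band neighbourhood the base turn is carried to the sliver twist of Gompf's
far Dehn twist.** [cite: GompfAGT2010, Thm 2.1 (proof, last paragraph: cut along the front face and reglue by δ)] -/
theorem turn (H : (fishJ ε hε hε2).ModelHyp) :
    ∀ p ∈ (fishJ ε hε hε2).endO H, ∀ b ∈ bandNbhd etaP, b ∉ fibreSliver (farSupport tauFar) →
      (fishJ ε hε hε2).iota H p = toSurg (fishNu hε hε2) ((mtGlueData tubeShearDiffeo).inr b) →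
      (fishJ ε hε hε2).iota H ((fishJ ε hε hε2).baseTurnΨ H E1_pos E1_le_half eaP ebP p) =
        toSurg (fishNu hε hε2) ((mtGlueData tubeShearDiffeo).inr (sliverTwist (farDehn tauFar_pos tauFar_lt) b)) := by
  intro p hp b hb _ hpb
  have hπ := Real.pi_gt_three
  obtain ⟨x, s, hs0, hs1, rfl⟩ := exists_mtPt_rep p
  rw [IotaData.mem_endO, z1Of_mtPt hε hε2 H x (by linarith) hs1] at hp
  rw [iota_mtPt hε hε2 H x hs0 hs1] at hpb
  obtain ⟨hbox, -, hb1, hb2⟩ := box_of_eq_inr hε hε2 hp hb hpb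
  obtain ⟨-, hre, ht1, ht2⟩ := far_of_mem_bandNbhd hb
  rw [hb1] at hre; rw [hb2] at ht1 ht2
  simp only [Circle.coe_exp, Complex.exp_ofReal_mul_I_re] at hre
  obtain ⟨hθ, hσ0, hσ4, hea, hflatT, hflatY, hband⟩ := top_of_band hε hε2 hp ⟨hs0, hs1⟩ ht2 hre
  obtain ⟨he0, he1⟩ := depth_mem' hε hε2 hp
  set e := (fishJ ε hε hε2).depth x.1 with he
  have hE := E1_le
  have hs' : 1 / 2 < s ∧ s < 3 / 2 := ⟨by linarith, hs1⟩
  -- the base turn: a full turn `u = 2π` acting by `e^{2πi κ}` on the fibre, `κ = 1 + κ₀(e, σ)`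
  set D := (fishJ ε hε hε2).fishD H E1_pos E1_le_half eaP ebP with hD
  have hu : D.u x.1 = 2 * π := by
    show (fishJ ε hε hε2).uTurn eaP ebP x.1 = 2 * π
    exact (fishJ ε hε hε2).uTurn_of_le eaP_lt_ebP hea.le
  have hκ : D.κ x.1 s = 1 + kap0 e (s - 1) := by
    show kapV ((fishJ ε hε hε2).depth x.1) s = 1 + kap0 e (s - 1)
    rw [kapV, ← he, kap0_of_ge (by linarith [sigHi_lt_quarter])]
  set w : Circle := Circle.exp (2 * π * kap0 e (s - 1)) with hw
  have hR : (fishJ ε hε hε2).baseTurnΨ H E1_pos E1_le_half eaP ebP (mtPt ((fishJ ε hε hε2).Ψ H) x s) =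
      mtPt ((fishJ ε hε hε2).Ψ H) (x.1, x.2.1, x.2.2 * w) s := by
    rw [mtPt_of_mem_two x hs', (fishJ ε hε hε2).baseTurnΨ_inr H E1_pos E1_le_half eaP ebP, FishParamsD.twistTwo_apply, hu,
      fishTurn_two_pi D.lift_add_two_pi, hκ, mtPt_of_mem_two _ hs']
    congr 2
    simp only [hw, mul_add, mul_one, Circle.exp_add, Circle.exp_two_pi, one_mul]
  rw [hR, iota_mtPt hε hε2 H _ hs'.1.le hs'.2, iotaTwo_rotate_of_box hε hε2 hbox, boxP_rotate]
  -- the sliver twist: Gompf's far Dehn twist on the fibre, `t > 1`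
  have htb : 1 < (b.2 : ℝ) := by rw [hb2, hflatT, bxH]; linarith
  rw [sliverTwist_of_one_lt _ htb, ← show mtPt tubeShearDiffeo (farDehn tauFar_pos tauFar_lt b.1) (b.2 : ℝ) =
      (mtGlueData tubeShearDiffeo).inr (farDehn tauFar_pos tauFar_lt b.1, b.2) from mtPt_of_mem_two _ b.2.2, hb1, hb2, coe_farDehn,
    torusTwist]
  -- the circle map of the far lift at the face point is `e^{2πi κ₀}`
  have hg : circleMapOfLift (farLift tauFar) (Circle.exp (faceY (thetaV s) e)) = w := by
    rw [hw, hflatY]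
    refine (circleExp_two_pi_mul_kap0 he0.le (by linarith) hσ0.le hσ4 ?_).symm
    rw [← hflatY]; obtain ⟨-, b2⟩ := abs_lt.1 hband; linarith
  rw [hg]

include hε2 in
/-- **A band point above the sliver is the image of a shallow box point.** [folklore] -/
theorem exists_preimage_band (H : (fishJ ε hε hε2).ModelHyp) {X : ThreeTorus} (hsupp : X ∈ farSupport tauFar) {tb : ℝ}
    (htb : 1 < tb) (ht2 : tb ≤ 1 + etaP) :
    toSurg (fishNu hε hε2) (mtPt tubeShearDiffeo X tb) ∈ (fishJ ε hε hε2).iota H '' ((fishJ ε hε hε2).endO H : Set (MTorus ((fishJ ε hε hε2).Ψ H))) := by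
  have hπ := Real.pi_gt_three; have hπ4 := Real.pi_lt_d2
  -- data of the preimage
  have hη : etaP = bxH * E1 / 4 := rfl
  set e : ℝ := (tb - 1) / bxH with hedef
  have hE := E1_le; have hE0 := E1_pos
  have he0 : 0 < e := by rw [hedef, bxH]; linarith
  have he1 : e ≤ E1 / 4 := by rw [hedef, bxH, div_le_iff₀ (by norm_num)]; rw [hη, bxH] at ht2; linarith
  -- the fibre angle `y ∈ [π - τ, π + τ]` with `e^{iy} = z₂`
  set z : ℂ := ((X.2.1 : Circle) : ℂ) with hz
  have hre : z.re ≤ -Real.cos tauFar := by have : z.re ≤ Real.cos (π - tauFar) := hsupp; rwa [Real.cos_pi_sub] at this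
  have hτ0 : 0 < Real.cos tauFar := Real.cos_pos_of_mem_Ioo ⟨by rw [tauFar]; linarith, by rw [tauFar]; linarith⟩
  obtain ⟨y, hyz, hy1, hy2⟩ : ∃ y : ℝ, Circle.exp y = X.2.1 ∧ π - tauFar ≤ y ∧ y ≤ π + tauFar := by
    have harg : π / 2 < |arg z| := by
      by_contra hcon
      have := Complex.abs_arg_le_pi_div_two_iff.1 (not_lt.1 hcon)
      linarith
    have hle := Complex.arg_le_pi z; have hgt := Complex.neg_pi_lt_arg z
    -- `cos y = re z ≤ -cos τ` with `|y - π| ≤ π/2` gives `|y - π| ≤ τ`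
    have key : ∀ y : ℝ, Real.cos y = z.re → |y - π| ≤ π / 2 → π - tauFar ≤ y ∧ y ≤ π + tauFar := by
      intro y hy hyπ
      have hc : Real.cos tauFar ≤ Real.cos (|y - π|) := by rw [Real.cos_abs, Real.cos_sub_pi]; linarith
      have habs : |y - π| ≤ tauFar := by
        by_contra hcon
        have := Real.cos_lt_cos_of_nonneg_of_le_pi (by rw [tauFar]; norm_num) (by linarith) (not_le.1 hcon)
        linarith
      constructor <;> linarith [(abs_le.1 habs).1, (abs_le.1 habs).2]
    have hcosarg : Real.cos (arg z) = z.re := by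
      have h1 : ‖z‖ = 1 := by rw [hz]; exact Circle.norm_coe _
      have := Complex.cos_arg (show z ≠ 0 from fun h0 ↦ by rw [h0, norm_zero] at h1; exact zero_ne_one h1)
      rw [this, h1, div_one]
    rcases le_or_gt 0 (arg z) with h0 | h0
    · obtain ⟨k1, k2⟩ := key (arg z) hcosarg (by rw [abs_of_nonneg h0] at harg; rw [abs_le]; constructor <;> linarith)
      exact ⟨arg z, by rw [hz]; exact Circle.exp_arg X.2.1, k1, k2⟩
    · obtain ⟨k1, k2⟩ := key (arg z + 2 * π) (by rw [Real.cos_add_two_pi]; exact hcosarg)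
        (by rw [abs_of_neg h0] at harg; rw [abs_le]; constructor <;> linarith)
      exact ⟨arg z + 2 * π, by rw [Circle.exp_add, Circle.exp_two_pi, mul_one, hz]; exact Circle.exp_arg X.2.1, k1, k2⟩
  have hcY : cY = π - 1 / 4 := rfl
  have hτ : tauFar = 1 / 10 := rfl
  -- the base: `σ = arctan A / (2π)`, `A = (y - c_Y)/((1 - e) h) ∈ [3/4, 9/5]`
  set A : ℝ := (y - cY) / ((1 - e) * bxH) with hA
  have h1e : 0 < (1 - e) * bxH := mul_pos (by linarith) (by rw [bxH]; norm_num)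
  have hA1 : 3 / 4 ≤ A := by rw [hA, le_div_iff₀ h1e, bxH]; nlinarith
  have hA2 : A ≤ 9 / 5 := by rw [hA, div_le_iff₀ h1e, bxH]; nlinarith
  have hA0 : 0 < A := by linarith
  set σ : ℝ := Real.arctan A / (2 * π) with hσdef
  have h2π : (0:ℝ) < 2 * π := by positivity
  have hσeq : 2 * π * σ = Real.arctan A := by rw [hσdef]; field_simp
  have hatan1 : Real.arctan A ≤ bxPhi1 := by rw [bxPhi1]; exact Real.arctan_strictMono.monotone (by linarith)
  have hatan0 : 0 < Real.arctan A := Real.arctan_pos.2 hA0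
  have hb15 : bxPhi1 < 2 * π / 5 := by
    by_contra hcon; rw [not_lt] at hcon
    have := Real.cos_le_cos_of_nonneg_of_le_pi (by positivity) (bxPhi1_lt_bxPhi2.le.trans bxPhi2_le_pi) hcon
    rw [cos_bxPhi.1] at this; linarith [cos_two_pi_div_five_lt]
  have hσ0 : 0 < σ := by rw [hσdef]; positivity
  have hσ5 : σ < 1 / 5 := by
    have : 2 * π * σ < 2 * π * (1 / 5) := by rw [hσeq]; linarith
    exact lt_of_mul_lt_mul_left this h2π.le
  set s : ℝ := 1 + σ with hsdef
  have hs' : 1 / 2 < s ∧ s < 3 / 2 := ⟨by linarith, by linarith⟩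
  -- the model point
  set q : ℝ × ℝ × ℝ × ℝ := (e, arg ((X.1 * X.2.2 : Circle) : ℂ), 0, s) with hq
  set x0 := ((fishJ ε hε hε2).mexp q).1 with hx0
  set x : ThreeTorus := (x0.1, x0.2.1, X.2.2 * ((fishJ ε hε hε2).twistC ((fishJ ε hε hε2).lat x0.2.1) s)⁻¹) with hxdef
  have hdepth : (fishJ ε hε hε2).depth x.1 = e := by
    show (fishJ ε hε hε2).depth ((fishJ ε hε hε2).mexp q).1.1 = e
    exact (fishJ ε hε hε2).depth_mexp E1_pos (q := q) he0.le (by show e ≤ E1; linarith)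
  have him : 0 < (x.1 : ℂ).im := by
    show 0 < ((modelExp (fishJ ε hε hε2).E₁ (fishJ ε hε hε2).θ₀ (fishJ ε hε hε2).nj q).1.1 : ℂ).im
    exact im_modelExp_fst_fst_pos E1_pos (q := q) he0 (by show e < E1; linarith)
  have hlat : Circle.exp ((fishJ ε hε hε2).lat x.2.1) = X.1 * X.2.2 := by
    show Circle.exp ((fishJ ε hε hε2).lat ((fishJ ε hε hε2).mexp q).1.2.1) = X.1 * X.2.2
    rw [(fishJ ε hε hε2).exp_lat_mexp q]; exact Circle.exp_arg _
  -- the face at the model point: flat sector, height `y`, time `t_b`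
  have hθ : |thetaV s - π / 2| ≤ bxPhi1 := by
    rw [abs_thetaV_sub, show s - 1 = σ by rw [hsdef]; ring, abs_of_pos hσ0, hσeq]; exact hatan1
  have hT : faceT (thetaV s) ((fishJ ε hε hε2).depth x.1) = tb := by
    rw [faceT_flat hθ, hdepth, hedef, bxH]; ring
  have hne : (1 - e) * bxH ≠ 0 := h1e.ne'
  have hYs : faceY (thetaV s) ((fishJ ε hε hε2).depth x.1) = y := by
    rw [faceY_flat_thetaV hθ, hdepth, show s - 1 = σ by rw [hsdef]; ring, hσeq, Real.tan_arctan, hA, mul_div_cancel₀ _ hne]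
    ring
  -- box mode: `|p₀| ≥ im p₀ = y - c_Y ≥ 3/20 > r_c`
  have hbox : (fishJ ε hε hε2).rc ≤ (fishJ ε hε hε2).holeDist x s := by
    obtain ⟨-, -, -, -, -, hrc1, -⟩ := radii hε hε2
    have hs1 : |s - 1| < 1 / 5 := by rw [show s - 1 = σ by rw [hsdef]; ring, abs_of_pos hσ0]; exact hσ5
    rw [IotaData.holeDist, if_pos hs1]
    obtain ⟨-, hi⟩ := holeP0_re_im hε hε2 x s
    have him' : ((fishJ ε hε hε2).holeP0 x s).im = y - cY := by
      rw [hi, hdepth, show s - 1 = σ by rw [hsdef]; ring, hσeq, Real.tan_arctan, hA, mul_div_cancel₀ _ hne]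
    have := abs_im_le_norm ((fishJ ε hε hε2).holeP0 x s)
    rw [him', abs_of_nonneg (by linarith)] at this
    linarith
  refine ⟨mtPt ((fishJ ε hε hε2).Ψ H) x s, by rw [SetLike.mem_coe, IotaData.mem_endO, z1Of_mtPt hε hε2 H x (by linarith) hs'.2]; exact him, ?_⟩
  rw [iota_mtPt hε hε2 H x hs'.1.le hs'.2]
  have hv : (fishJ ε hε hε2).iotaTwo (x, s) = (fishJ ε hε hε2).boxP x s := by
    have := iotaTwo_rotate_of_box hε hε2 (x := x) hbox 1
    simpa using this
  rw [hv, boxP_eq, hT, hYs, hyz]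
  congr 2
  refine Prod.ext ?_ (Prod.ext rfl ?_)
  · show Circle.exp ((fishJ ε hε hε2).lat x0.2.1) * (X.2.2 * ((fishJ ε hε hε2).twistC ((fishJ ε hε hε2).lat x0.2.1) s)⁻¹ *
      (fishJ ε hε hε2).twistC ((fishJ ε hε hε2).lat x0.2.1) s)⁻¹ = X.1
    have hlat' : Circle.exp ((fishJ ε hε hε2).lat x0.2.1) = X.1 * X.2.2 := hlat
    rw [inv_mul_cancel_right, hlat', mul_inv_cancel_right]
  · show X.2.2 * ((fishJ ε hε hε2).twistC ((fishJ ε hε hε2).lat x0.2.1) s)⁻¹ * (fishJ ε hε hε2).twistC ((fishJ ε hε hε2).lat x0.2.1) s = X.2.2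
    rw [inv_mul_cancel_right]

include hε2 in
/-- **`fix`: every point of the band neighbourhood moved by the sliver twist is hit by a shallow box
point of the model end.** [cite: GompfAGT2010, Thm 2.1 (proof, last paragraph)] -/
theorem fix (H : (fishJ ε hε hε2).ModelHyp) :
    ∀ b ∈ bandNbhd etaP, b ∉ fibreSliver (farSupport tauFar) →
      toSurg (fishNu hε hε2) ((mtGlueData tubeShearDiffeo).inr b) ∉ (fishJ ε hε hε2).iota H '' ((fishJ ε hε hε2).endO H : Set (MTorus ((fishJ ε hε hε2).Ψ H))) →
      sliverTwist (farDehn tauFar_pos tauFar_lt) b = b := by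
  intro b hb _ hnot
  by_contra hne
  -- the point is above the sliver and in the support of `δ`
  have htb : 1 < (b.2 : ℝ) := by
    by_contra h; exact hne (sliverTwist_of_le_one _ (not_lt.1 h))
  rw [sliverTwist_of_one_lt _ htb] at hne
  have hsupp : b.1 ∈ farSupport tauFar := by
    by_contra h
    exact hne (Prod.ext (farDehn_eq_self tauFar_pos tauFar_lt h) rfl)
  obtain ⟨-, -, -, ht2⟩ := far_of_mem_bandNbhd hb
  apply hnot
  rw [← show mtPt tubeShearDiffeo b.1 (b.2 : ℝ) = (mtGlueData tubeShearDiffeo).inr b from by rw [mtPt_of_mem_two _ b.2.2]]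
  exact exists_preimage_band hε hε2 H hsupp htb ht2.le

end Turn

/-! ### The support: `closure (ι '' moved)` -/

section HK

/-- **The base turn at a represented point** (both cylinders). [folklore] -/
theorem baseTurn_mtPt (H : (fishJ ε hε hε2).ModelHyp) (x : ThreeTorus) {s : ℝ} (hs0 : 0 < s) (hs1 : s < 3 / 2) :
    (fishJ ε hε hε2).baseTurnΨ H E1_pos E1_le_half eaP ebP (mtPt ((fishJ ε hε hε2).Ψ H) x s) =
      mtPt ((fishJ ε hε hε2).Ψ H) (fishTurn ((fishJ ε hε hε2).fishD H E1_pos E1_le_half eaP ebP).lift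
        (((fishJ ε hε hε2).fishD H E1_pos E1_le_half eaP ebP).κ x.1 s) (((fishJ ε hε hε2).fishD H E1_pos E1_le_half eaP ebP).u x.1) x) s := by
  by_cases h2 : 1 / 2 < s
  · rw [mtPt_of_mem_two x ⟨h2, hs1⟩, (fishJ ε hε hε2).baseTurnΨ_inr, FishParamsD.twistTwo_apply, mtPt_of_mem_two _ ⟨h2, hs1⟩]
  · have h1 : 0 < s ∧ s < 1 := ⟨hs0, by linarith⟩
    rw [mtPt_of_mem_one x h1, (fishJ ε hε hε2).baseTurnΨ_inl, FishParamsD.twistOne_apply, mtPt_of_mem_one _ h1]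

/-- `σ_hi < 1/5`. [folklore] -/
theorem sigHi_lt_fifth : sigHi < 1 / 5 := by
  have hπ := Real.pi_gt_three
  have hb15 : bxPhi1 < 2 * π / 5 := by
    by_contra hcon; rw [not_lt] at hcon
    have := Real.cos_le_cos_of_nonneg_of_le_pi (by positivity) (bxPhi1_lt_bxPhi2.le.trans bxPhi2_le_pi) hcon
    rw [cos_bxPhi.1] at this; linarith [cos_two_pi_div_five_lt]
  have h1 : Real.arctan (11 / 4) < bxPhi1 := by rw [bxPhi1]; exact Real.arctan_strictMono (by norm_num)
  rw [sigHi, div_lt_iff₀ (by positivity)]; linarith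

include hε2 in
/-- **A shallow moved point is a band box point**: its image is `toSurg [X, t]` with `X` in the far
support and `1 < t ≤ 1 + η'`. [folklore] -/
theorem image_of_moved_shallow (H : (fishJ ε hε hε2).ModelHyp) {x : ThreeTorus} (hx : 0 < (x.1 : ℂ).im) {s : ℝ}
    (hs0 : 1 / 2 ≤ s) (hs1 : s < 3 / 2) (hea : (fishJ ε hε hε2).depth x.1 < eaP)
    (hmv : (fishJ ε hε hε2).baseTurnΨ H E1_pos E1_le_half eaP ebP (mtPt ((fishJ ε hε hε2).Ψ H) x s) ≠ mtPt ((fishJ ε hε hε2).Ψ H) x s) :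
    ∃ (X : ThreeTorus) (t : ℝ), X ∈ farSupport tauFar ∧ 1 < t ∧ t ≤ 1 + etaP ∧
      (fishJ ε hε hε2).iotaTwo (x, s) = toSurg (fishNu hε hε2) (mtPt tubeShearDiffeo X t) := by
  have hπ := Real.pi_gt_three
  obtain ⟨he0, he1⟩ := depth_mem' hε hε2 hx
  set e := (fishJ ε hε hε2).depth x.1 with he
  have hE := E1_le
  set D := (fishJ ε hε hε2).fishD H E1_pos E1_le_half eaP ebP with hD
  have hu : D.u x.1 = 2 * π := by
    show (fishJ ε hε hε2).uTurn eaP ebP x.1 = 2 * π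
    exact (fishJ ε hε hε2).uTurn_of_le eaP_lt_ebP hea.le
  have hκ : D.κ x.1 s = 1 + kap0 e (s - 1) := by
    show kapV ((fishJ ε hε hε2).depth x.1) s = 1 + kap0 e (s - 1)
    rw [kapV, ← he, kap0_of_ge (by linarith [sigHi_lt_quarter])]
  rw [baseTurn_mtPt hε hε2 H x (by linarith) hs1, hu, fishTurn_two_pi D.lift_add_two_pi, hκ] at hmv
  -- the fibre rotation is nontrivial: `κ₀ ∈ (0, 1)`
  set k := kap0 e (s - 1) with hk
  have hk01 : 0 < k ∧ k < 1 := by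
    have hw : Circle.exp (2 * π * (1 + k)) ≠ 1 := by
      intro h1; apply hmv
      simp only [h1, mul_one]
    rw [mul_add, mul_one, Circle.exp_add, Circle.exp_two_pi, one_mul] at hw
    have hk0 : 0 ≤ k := by
      rw [hk, kap0]; split_ifs
      · exact le_rfl
      · exact zero_le_one
      · exact Real.smoothTransition.nonneg _
    have hk1 : k ≤ 1 := by
      rw [hk, kap0]; split_ifs
      · exact zero_le_one
      · exact le_rfl
      · exact Real.smoothTransition.le_one _
    refine ⟨hk0.lt_of_ne fun h0 ↦ hw ?_, hk1.lt_of_ne fun h1 ↦ hw ?_⟩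
    · rw [← h0, mul_zero, Circle.exp_zero]
    · rw [h1, mul_one, Circle.exp_two_pi]
  -- hence `σ_lo < σ < σ_hi` and `0 < kapArg < 1`
  have hσlo : sigLo < s - 1 := by
    by_contra h; exact hk01.1.ne' (by rw [hk, kap0_of_le (not_lt.1 h)])
  have hσhi : s - 1 < sigHi := by
    by_contra h; exact hk01.2.ne (by rw [hk, kap0_of_ge (not_lt.1 h)])
  have hσ0 : 0 < s - 1 := sigLo_pos.trans hσlo
  have hσ4 : s - 1 < 1 / 4 := hσhi.trans sigHi_lt_quarter
  have hkeq : k = Real.smoothTransition (kapArg e (s - 1)) := kap0_eq he0.le (by linarith) (by linarith) hσ4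
  have harg0 : 0 < kapArg e (s - 1) := by
    by_contra h; rw [not_lt] at h
    exact hk01.1.ne' (by rw [hkeq, Real.smoothTransition.zero_of_nonpos h])
  have harg1 : kapArg e (s - 1) < 1 := by
    by_contra h; rw [not_lt] at h
    exact hk01.2.ne (by rw [hkeq, Real.smoothTransition.one_of_one_le h])
  have hτ : tauFar = 1 / 10 := rfl
  have hcY : cY = π - 1 / 4 := rfl
  have hy1 : π - tauFar < faceYs e (s - 1) := by
    rw [kapArg, hτ] at harg0
    have := (div_pos_iff_of_pos_right (by norm_num : (0:ℝ) < 5 * (1 / 10) / 4)).1 harg0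
    rw [hτ]; linarith
  have hy2 : faceYs e (s - 1) < π + tauFar / 4 := by
    rw [kapArg, hτ, div_lt_one (by norm_num : (0:ℝ) < 5 * (1 / 10) / 4)] at harg1
    rw [hτ]; linarith
  -- flat sector
  have hθ : |thetaV s - π / 2| ≤ bxPhi1 := by
    rw [abs_thetaV_sub, abs_of_pos hσ0]
    have h1 : 2 * π * (s - 1) < 2 * π * sigHi := by nlinarith
    have h2 : 2 * π * sigHi = Real.arctan (11 / 4) := by rw [sigHi]; field_simp
    have h3 : Real.arctan (11 / 4) < bxPhi1 := by rw [bxPhi1]; exact Real.arctan_strictMono (by norm_num)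
    linarith
  have hflatT := faceT_flat hθ e
  have hflatY := faceY_flat_thetaV hθ e
  -- box mode: `im p₀ = y - c_Y > 3/20 ≥ r_c`
  have hbox : (fishJ ε hε hε2).rc ≤ (fishJ ε hε hε2).holeDist x s := by
    obtain ⟨-, -, -, -, -, hrc1, -⟩ := radii hε hε2
    have hs1' : |s - 1| < 1 / 5 := by rw [abs_of_pos hσ0]; linarith [sigHi_lt_fifth]
    rw [IotaData.holeDist, if_pos hs1']
    obtain ⟨-, hi⟩ := holeP0_re_im hε hε2 x s
    have him' : ((fishJ ε hε hε2).holeP0 x s).im = faceYs e (s - 1) - cY := by rw [hi, faceYs]; ring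
    have := abs_im_le_norm ((fishJ ε hε hε2).holeP0 x s)
    rw [him', abs_of_nonneg (by linarith)] at this
    linarith
  have hv : (fishJ ε hε hε2).iotaTwo (x, s) = (fishJ ε hε hε2).boxP x s := by
    have := iotaTwo_rotate_of_box hε hε2 (x := x) hbox 1
    simpa using this
  refine ⟨_, faceT (thetaV s) e, ?_, by rw [hflatT, bxH]; nlinarith, by rw [hflatT, etaP, eaP] at *; rw [bxH]; nlinarith [hea.le], by rw [hv, boxP_eq]⟩
  -- the far support: `cos y ≤ -cos τ` for `|y - π| ≤ τ`
  show ((Circle.exp (faceY (thetaV s) e) : Circle) : ℂ).re ≤ Real.cos (π - tauFar)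
  rw [Circle.coe_exp, Complex.exp_ofReal_mul_I_re, hflatY, Real.cos_pi_sub]
  have hyy : faceYs e (s - 1) = cY + (1 - e) * bxH * Real.tan (2 * π * (s - 1)) := rfl
  rw [← hyy]
  have habs : |faceYs e (s - 1) - π| ≤ tauFar := by rw [abs_le]; constructor <;> linarith [hτ]
  have := Real.cos_le_cos_of_nonneg_of_le_pi (abs_nonneg _) (by rw [hτ]; linarith) habs
  rw [Real.cos_abs, Real.cos_sub_pi] at this
  linarith

/-- **The band set** `{toSurg [X, t] | X ∈ farSupport τ, 1 ≤ t ≤ 1 + η'}`. [folklore] -/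
def bandSet : Set (fishNu hε hε2).Surgered :=
  (fun q : ThreeTorus × ℝ ↦ toSurg (fishNu hε hε2) (mtPt tubeShearDiffeo q.1 q.2)) '' (farSupport tauFar ×ˢ Icc 1 (1 + etaP))

/-- A far-support point read in the second cylinder is far. [folklore] -/
theorem far_mtPt_of_mem_farSupport {X : ThreeTorus} (hX : X ∈ farSupport tauFar) {t : ℝ} (ht : 1 / 2 < t ∧ t < 3 / 2) :
    Far (mtPt tubeShearDiffeo X t) := by
  rw [mtPt_of_mem_two X ht]
  refine far_inr_of_re_neg ?_
  have h : ((X.2.1 : Circle) : ℂ).re ≤ Real.cos (π - tauFar) := hX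
  rw [Real.cos_pi_sub] at h
  have hτ0 : 0 < Real.cos tauFar := Real.cos_pos_of_mem_Ioo ⟨by rw [tauFar]; linarith [Real.pi_gt_three], by rw [tauFar]; linarith [Real.pi_gt_three]⟩
  exact lt_of_le_of_lt h (by linarith)

include hε2 in
/-- The band set is closed (a continuous image of a compact set). [folklore] -/
theorem isClosed_bandSet : IsClosed (bandSet hε hε2) := by
  refine (IsCompact.image_of_continuousOn ((isClosed_farSupport tauFar).isCompact.prod isCompact_Icc) ?_).isClosed
  rintro ⟨X, t⟩ ⟨hX, ht1, ht2⟩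
  have hη := etaP_le
  have ht : 1 / 2 < t ∧ t < 3 / 2 := ⟨by linarith, by linarith⟩
  have hc := (far_mtPt_of_mem_farSupport hX ht).mem_complement hε hε2
  have h1 : ContinuousAt (toSurg (fishNu hε hε2)) (mtPt tubeShearDiffeo X t) := (contMDiffAt_toSurg hc).continuousAt
  have h2 : ContinuousAt (fun p : ThreeTorus × ℝ ↦ mtPt tubeShearDiffeo p.1 p.2) (X, t) :=
    (contMDiffAt_mtPt (ψ := tubeShearDiffeo) (p := (X, t)) (by simp only; linarith) ht.2).continuousAt
  exact (ContinuousAt.comp (f := fun p : ThreeTorus × ℝ ↦ mtPt tubeShearDiffeo p.1 p.2) (g := toSurg (fishNu hε hε2)) h1 h2).continuousWithinAt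

/-- **The deep set** `{p | e_a ≤ depth ≤ e_b, im z₁ ≥ 0}` of the model, a compact subset of the end. [folklore] -/
def deepSet (H : (fishJ ε hε hε2).ModelHyp) : Set (MTorus ((fishJ ε hε hε2).Ψ H)) :=
  (fishJ ε hε hε2).z1Of H ⁻¹' {z : Circle | eaP ≤ (fishJ ε hε hε2).depth z ∧ (fishJ ε hε hε2).depth z ≤ ebP ∧ 0 ≤ (z : ℂ).im}

/-- `IsCompact (deepSet hε hε2 H)`. [folklore] -/
theorem isCompact_deepSet (H : (fishJ ε hε hε2).ModelHyp) : IsCompact (deepSet hε hε2 H) := by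
  refine (IsClosed.preimage ((fishJ ε hε hε2).contMDiff_z1Of H).continuous ?_).isCompact
  have hd : Continuous (fishJ ε hε hε2).depth := ((fishJ ε hε hε2).contMDiff_depth).continuous
  have him : Continuous fun z : Circle ↦ (z : ℂ).im := Complex.continuous_im.comp continuous_subtype_val
  have hset : {z : Circle | eaP ≤ (fishJ ε hε hε2).depth z ∧ (fishJ ε hε hε2).depth z ≤ ebP ∧ 0 ≤ (z : ℂ).im} =
      {z | eaP ≤ (fishJ ε hε hε2).depth z} ∩ ({z | (fishJ ε hε hε2).depth z ≤ ebP} ∩ {z | 0 ≤ (z : ℂ).im}) := rfl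
  rw [hset]
  exact (isClosed_le continuous_const hd).inter ((isClosed_le hd continuous_const).inter (isClosed_le continuous_const him))

/-- `deepSet hε hε2 H ⊆ ((fishJ ε hε hε2).endO H : Set _)`. [folklore] -/
theorem deepSet_subset_endO (H : (fishJ ε hε hε2).ModelHyp) : deepSet hε hε2 H ⊆ ((fishJ ε hε hε2).endO H : Set _) := by
  intro p hp
  obtain ⟨h1, h2, h3⟩ := hp
  rw [SetLike.mem_coe, IotaData.mem_endO]
  set z := (fishJ ε hε hε2).z1Of H p
  have hE := E1_pos
  have hre : (z : ℂ).re < 1 := by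
    have : (fishJ ε hε hε2).depth z = E1 * (1 - (z : ℂ).re) / 2 := rfl
    rw [this, eaP] at h1; nlinarith
  have hre' : -1 < (z : ℂ).re := by
    have : (fishJ ε hε hε2).depth z = E1 * (1 - (z : ℂ).re) / 2 := rfl
    rw [this, ebP] at h2; nlinarith
  have hsq : (z : ℂ).re ^ 2 + (z : ℂ).im ^ 2 = 1 := by
    have := Circle.normSq_coe z
    rw [Complex.normSq_apply] at this; nlinarith
  refine h3.lt_of_ne fun h0 ↦ ?_
  rw [← h0] at hsq
  nlinarith

include hε2 in
/-- **The image of the moved set lies in the band set and the image of the deep set.** [folklore] -/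
theorem image_moved_subset (H : (fishJ ε hε hε2).ModelHyp) :
    (fishJ ε hε hε2).iota H '' (fishJ ε hε hε2).moved H E1_pos E1_le_half eaP ebP ⊆
      bandSet hε hε2 ∪ (fishJ ε hε hε2).iota H '' deepSet hε hε2 H := by
  rintro _ ⟨p, ⟨hp, hmv⟩, rfl⟩
  obtain ⟨x, s, hs0, hs1, rfl⟩ := exists_mtPt_rep p
  have hz := z1Of_mtPt hε hε2 H x (by linarith) hs1
  rw [IotaData.mem_endO, hz] at hp
  rcases lt_or_ge ((fishJ ε hε hε2).depth x.1) eaP with hea | hea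
  · left
    obtain ⟨X, t, hX, ht1, ht2, hv⟩ := image_of_moved_shallow hε hε2 H hp hs0 hs1 hea hmv
    exact ⟨(X, t), ⟨hX, ht1.le, ht2⟩, by rw [iota_mtPt hε hε2 H x hs0 hs1, hv]⟩
  · right
    refine ⟨_, ?_, rfl⟩
    rw [deepSet, Set.mem_preimage, hz]
    refine ⟨hea, ?_, hp.le⟩
    -- not moved at depth `≥ e_b`
    by_contra hcon
    rw [not_le] at hcon
    apply hmv
    have hu : ((fishJ ε hε hε2).fishD H E1_pos E1_le_half eaP ebP).u x.1 = 0 := (fishJ ε hε hε2).uTurn_of_ge eaP_lt_ebP hcon.le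
    rw [baseTurn_mtPt hε hε2 H x (by linarith) hs1, hu, fishTurn_zero ((fishJ ε hε hε2).fishD H E1_pos E1_le_half eaP ebP).lift_add_two_pi]

include hε2 in
/-- **The closure of the image of the moved set.** [folklore] -/
theorem closure_image_moved_subset (H : (fishJ ε hε hε2).ModelHyp) {δ : ℝ} (HL : (fishJ ε hε hε2).LocHyp δ) :
    closure ((fishJ ε hε hε2).iota H '' (fishJ ε hε hε2).moved H E1_pos E1_le_half eaP ebP) ⊆
      bandSet hε hε2 ∪ (fishJ ε hε hε2).iota H '' deepSet hε hε2 H := by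
  refine closure_minimal (image_moved_subset hε hε2 H) ((isClosed_bandSet hε hε2).union ?_)
  have hcont : ContinuousOn ((fishJ ε hε hε2).iota H) ((fishJ ε hε hε2).endO H : Set _) := by
    rw [continuousOn_iff_continuous_restrict]
    exact (IsLocalDiffeomorph.contMDiff ((fishJ ε hε hε2).isLocalDiffeomorph_iotaO H HL)).continuous
  exact ((isCompact_deepSet hε hε2 H).image_of_continuousOn (hcont.mono (deepSet_subset_endO hε hε2 H))).isClosed

include hε2 in
/-- A point of the far sliver is not in `Y`. [folklore] -/
theorem toSurg_sliver_not_mem_Yop {X : ThreeTorus} (hX : X ∈ farSupport tauFar) :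
    toSurg (fishNu hε hε2) (mtPt tubeShearDiffeo X 1) ∉ (fishJ ε hε hε2).Yop := by
  have ht : (1:ℝ) / 2 < 1 ∧ (1:ℝ) < 3 / 2 := ⟨by norm_num, by norm_num⟩
  have hfar := far_mtPt_of_mem_farSupport hX ht
  have hc := hfar.mem_complement hε hε2
  intro hmem
  rw [toSurg_eq_inl hc] at hmem
  rcases (CircleNbhd.mem_localOpens_iff _).1 hmem with ⟨a, ha, hinl⟩ | ⟨d, hd⟩
  · have := (fishNu hε hε2).glueData.inl_injective hinl
    rw [this] at ha
    have ha' : mtPt tubeShearDiffeo X 1 ∈ prodSliverCompl tubeShearDiffeo (isClosed_farSupport tauFar) := ha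
    exact ((mem_prodSliverCompl_iff _ _ _).1 ha') (X, ⟨1, ht⟩) ⟨hX, rfl⟩ (mtPt_of_mem_two X ht).symm
  · exact hfar.toSurg_ne_inr hε hε2 d (by rw [toSurg_eq_inl hc]; exact hd.symm)

include hε2 in
/-- **`hK`: the support read in `Y` lies in the image of the end.** [cite: GompfAGT2010, Lemma 2.2 (proof: the turn is the identity near ∂Φ)] -/
theorem hK (H : (fishJ ε hε hε2).ModelHyp) :
    closure ((fishJ ε hε hε2).iota H '' (fishJ ε hε hε2).moved H E1_pos E1_le_half eaP ebP) ∩ ((fishJ ε hε hε2).Yop : Set _) ⊆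
      (fishJ ε hε hε2).iota H '' ((fishJ ε hε hε2).endO H : Set _) := by
  rintro y ⟨hy, hyY⟩
  rcases closure_image_moved_subset hε hε2 H (locHyp hε hε2) hy with ⟨⟨X, t⟩, ⟨hX, ht1, ht2⟩, rfl⟩ | ⟨p, hp, rfl⟩
  · dsimp only at hX ht1 ht2 hyY ⊢
    rcases ht1.eq_or_lt with h1 | h1
    · subst h1
      exact absurd hyY (toSurg_sliver_not_mem_Yop hε hε2 hX)
    · exact exists_preimage_band hε hε2 H hX h1 ht2
  · exact ⟨p, deepSet_subset_endO hε hε2 H hp, rfl⟩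

/-! ### The support lies in the twisted cylinder neighbourhood -/

include hε2 in
/-- **A good old point read in `X^σ` lies in the local twisted cylinder neighbourhood.** [folklore] -/
theorem toSurg_mem_localOpens_TN {r : ℝ} (hr : r ≤ π) (hεr : ε ≤ r) {m : MTorus tubeShearDiffeo} (hm : TNGood hr m) :
    toSurg (fishNu hε hε2) m ∈ (fishNu hε hε2).localOpens
      (twistNbhd tubeShearDiffeo 1 (axisTube hr) (Diffeotopy.refl 𝓣 ThreeTorus) (Diffeomorph.refl 𝓣 ThreeTorus ∞)) := by
  rw [toSurg]
  split_ifs with h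
  · exact CircleNbhd.inl_mem_localOpens _ (mem_twistNbhd_refl_of_half_le _ _ (by norm_num) hm)
  · exact CircleNbhd.inl_mem_localOpens _ (mem_twistNbhd_refl_of_half_le _ _ (by norm_num)
      (tnGood_of_mem_range hε hε2 hr hεr (p := ((fishNu hε hε2).basePtA : MTorus tubeShearDiffeo)) ⟨_, rfl⟩))

include hε2 in
/-- A good-or-new point lies in the local twisted cylinder neighbourhood. [folklore] -/
theorem mem_localOpens_TN_of_tnPt {r : ℝ} (hr : r ≤ π) (hεr : ε ≤ r) {p : (fishNu hε hε2).Surgered} (hp : TNPt hε hε2 hr p) :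
    p ∈ (fishNu hε hε2).localOpens
      (twistNbhd tubeShearDiffeo 1 (axisTube hr) (Diffeotopy.refl 𝓣 ThreeTorus) (Diffeomorph.refl 𝓣 ThreeTorus ∞)) := by
  rcases hp with ⟨b, rfl⟩ | ⟨m, rfl, hm⟩
  · exact CircleNbhd.inr_mem_localOpens _ b
  · exact toSurg_mem_localOpens_TN hε hε2 hr hεr hm

include hε2 in
/-- **`hKT`: the support lies in the local twisted cylinder neighbourhood** (for `ε ≤ r`). [cite: GompfAGT2010, Lemma 2.2 (proof) and Thm 2.1 (proof, last paragraph)] -/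
theorem hKT (H : (fishJ ε hε hε2).ModelHyp) {r : ℝ} (hr : r ≤ π) (hεr : ε ≤ r) :
    closure ((fishJ ε hε hε2).iota H '' (fishJ ε hε hε2).moved H E1_pos E1_le_half eaP ebP) ⊆
      ((fishNu (fishJ ε hε hε2).hε (fishJ ε hε hε2).hε2).localOpens
        (twistNbhd tubeShearDiffeo 1 (axisTube hr) (Diffeotopy.refl 𝓣 ThreeTorus) (Diffeomorph.refl 𝓣 ThreeTorus ∞)) : Set _) := by
  intro y hy
  rcases closure_image_moved_subset hε hε2 H (locHyp hε hε2) hy with ⟨⟨X, t⟩, ⟨hX, ht1, ht2⟩, rfl⟩ | ⟨p, hp, rfl⟩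
  · dsimp only at hX ht1 ht2 ⊢
    have hη := etaP_le
    exact toSurg_mem_localOpens_TN hε hε2 hr hεr (tnGood_mtPt_of_lt hr (by linarith) (by linarith))
  · have hpO := deepSet_subset_endO hε hε2 H hp
    obtain ⟨x, s, hs0, hs1, rfl⟩ := exists_mtPt_rep p
    rw [SetLike.mem_coe, IotaData.mem_endO, z1Of_mtPt hε hε2 H x (by linarith) hs1] at hpO
    rw [SetLike.mem_coe, iota_mtPt hε hε2 H x hs0 hs1]
    rcases iotaTwo_modes hε hε2 x s with ⟨-, hp1, hv⟩ | ⟨-, hp1, hp2, hv⟩ | ⟨-, hv⟩ <;> rw [hv]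
    · obtain ⟨ht, hζ, hw, -⟩ := hole_tube hε hε2 hpO hp1
      rw [ht]
      exact mem_localOpens_TN_of_tnPt hε hε2 hr hεr (hole_tn hε hε2 hεr hw hζ)
    · rw [cornerP_eq]
      obtain ⟨-, hS1, hS2, -⟩ := far_corner hε hε2 hpO hp1 hp2
      exact toSurg_mem_localOpens_TN hε hε2 hr hεr (tnGood_mtPt_of_lt hr (by linarith) hS2)
    · rw [boxP_eq]
      obtain ⟨hT1, hT2, -⟩ := box_mem hε hε2 hpO s
      obtain ⟨he0, -⟩ := depth_mem' hε hε2 hpO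
      have htb : 1 < faceT (thetaV s) ((fishJ ε hε hε2).depth x.1) := by rw [bxH] at hT1; linarith
      exact toSurg_mem_localOpens_TN hε hε2 hr hεr (tnGood_mtPt_of_lt hr (by linarith) (by linarith))

/-! ### The end hypotheses and Gompf's theorem -/

include hε2 in
/-- **The geometric hypotheses of the fishtail end map hold for the concrete data** with
`e_a = E₁/4`, `e_b = E₁/2`, `η' = h E₁/4`, at any tube radius `r ≥ ε` (`r ≤ π`). [cite: GompfAGT2010, Lemma 2.2 (proof) and Thm 2.1 (proof, last paragraph)] -/
theorem endHyp (H : (fishJ ε hε hε2).ModelHyp) {r : ℝ} (hr : r ≤ π) (hεr : ε ≤ r) :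
    (fishJ ε hε hε2).EndHyp H E1_pos E1_le_half eaP ebP etaP hr where
  inj := injective_iotaO hε hε2 H
  memY := memY hε hε2 H
  turn := turn hε hε2 H
  fix := fix hε hε2 H
  hK := hK hε hε2 H
  hKT := hKT hε hε2 H hr hεr

end HK

end FP

end Literature.Topology.FourManifolds
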